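import Summits.CriticalPhenomena.Ising3D.BlockTaylorGermFamilies
import Mathlib.Tactic.Linarith
import Mathlib.Tactic.Positivity
import Mathlib.Tactic.Ring
import HarnessLib

/-!
# T4 for DERIVATIVE functionals, proved: termwise action and box exclusion from the typed axioms
(cell `pub-ising3x`, seat boot-1; gate (g0) of the M3-γ milestone, part 3e — the assembly)

HONEST FRAMING: lottery ticket; floor = tightest certified 3D Ising CFT bounds; no exact-solution
claim without a proof.

`DualFunctional.lean` (the tree) left "termwise action for derivative functionals" as the one open
obligation of the dual argument (REFEREE T4; pub-ising3d `T4A-DESIGN.md`). Parts 1–3d built the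
derivative (`Taylor`) functionals as honest linear maps and reduced their termwise action to the
analytic input `HasCrossFGerms`. This file discharges that input from the typed axioms A1–A2
(`hasCrossFGerms_of_axioms`: at every diagonal point `(x,x)`, `0 < x < 1`, majorant radius any
`ρ < x(1-x)`, for data with `Δ_σ ≠ Δ_ε`, `4Δ_σε² ≠ 1`, `Δ_σ ≠ 1`) and concludes:

* `appliesTermwise_of_isTaylorAt_of_axioms` — **T4-A**: every crossing functional whose five
  components are finite combinations of Taylor coefficients at `(x,x)` acts termwise on the five sum
  rules of every datum satisfying `SatisfiesBootstrapAxioms` (with the three side conditions);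
* `boxExcluded_of_taylorCrossing` — **box exclusion by a derivative functional**: positivity
  (`IsPositiveAt`) on a set `Q` of external dimensions avoiding `Δ_σ = Δ_ε`, `4(Δ_σ-Δ_ε)² = 1`,
  `Δ_σ = 1` gives `BoxExcluded Q`; `boxExcluded_of_taylorCrossing_of_gap` — the form used on the Ising
  window (`Δ_σ < 1`, `Δ_ε > Δ_σ + 1/2`, e.g. `W = [0.505,0.535] × [1.2,1.6]`).

So a Λ-derivative rational certificate (architecture γ of the cell's SCOPE §2) now closes a box by
the SAME typed chain as the point-functional certificates of pub-ising3d: what remains for M3-γ is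
the certificate side — the closed-form action on a `z`-series term (g0′), the region checks (g2) and
the L-odd-tail lemma (g1). Sources: Kos–Poland–Simmons-Duffin 2014 §3.2–3.3 (derivative functionals);
Pappadopulo–Rychkov–Espin–Rattazzi 2012 §4–5 (OPE convergence = the A1 clause used for the M-test).
-/

namespace Summit.CriticalPhenomena.Ising3D

open Finset Set
open Literature.MathematicalPhysics.QuantumFieldTheory.ConformalBootstrap3D

section Axioms

variable {D : SigmaEpsilonData} {x ρ : ℝ}

/-- Mixed weights `λ_{σσ} λ_{εε}` are summable against `gp (X,X)` (AM–GM + the A1 clause). [folklore] -/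
theorem summable_lam_mul_gp (hD : D.SatisfiesBootstrapAxioms) {X : ℝ} (hX0 : 0 < X) (hX1 : X < 1) :
    Summable fun i => |D.lamσσ i * D.lamεε i| * D.gp i X X := by
  obtain ⟨h1, h2, -⟩ := hD.2.2.1 X hX0 hX1
  refine ((h1.add h2).div_const 2).of_nonneg_of_le
    (fun i => mul_nonneg (abs_nonneg _) (gp_diag_nonneg hD i hX0 hX1)) fun i => ?_
  have hg := gp_diag_nonneg hD i hX0 hX1
  have hab : |D.lamσσ i * D.lamεε i| ≤ (D.lamσσ i ^ 2 + D.lamεε i ^ 2) / 2 := by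
    rw [abs_mul]
    nlinarith [sq_nonneg (|D.lamσσ i| - |D.lamεε i|), sq_abs (D.lamσσ i), sq_abs (D.lamεε i),
      abs_nonneg (D.lamσσ i), abs_nonneg (D.lamεε i)]
  calc |D.lamσσ i * D.lamεε i| * D.gp i X X ≤ (D.lamσσ i ^ 2 + D.lamεε i ^ 2) / 2 * D.gp i X X :=
        mul_le_mul_of_nonneg_right hab hg
    _ = _ := by ring

/-- **The analytic input of T4-A, discharged from the axioms**: at the diagonal point `(x,x)` with any
majorant radius `ρ < x(1-x)`, an axiom-satisfying datum with `Δ_σ ≠ Δ_ε`, `4Δ_σε² ≠ 1`, `Δ_σ ≠ 1`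
has `HasCrossFGerms D x x ρ`. [folklore] -/
theorem hasCrossFGerms_of_axioms (hD : D.SatisfiesBootstrapAxioms) (hne : D.Δσ ≠ D.Δε)
    (hs4 : 4 * D.Δσε ^ 2 ≠ 1) (hσ1 : D.Δσ ≠ 1) (hx0 : 0 < x) (hx1 : x < 1) (hρ0 : 0 < ρ)
    (hρ : ρ < x * (1 - x)) : HasCrossFGerms D x x ρ := by
  have hX₁ := bgX₁_pos_lt hx0 hρ
  have hX₂ := bgX₂_pos_lt hx1 hρ
  have hA₁ := hD.2.2.1 _ hX₁.1 hX₁.2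
  have hA₂ := hD.2.2.1 _ hX₂.1 hX₂.2
  have habs2 : ∀ (f : D.ιp → ℝ) (i : D.ιp), |f i ^ 2| = f i ^ 2 := fun f i => abs_of_nonneg (sq_nonneg _)
  have habs3 : ∀ j, |(-1 : ℝ) ^ D.ℓm j * D.lamσε j ^ 2| = D.lamσε j ^ 2 := fun j => by
    rw [abs_mul, abs_pow, abs_neg, abs_one, one_pow, one_mul, abs_of_nonneg (sq_nonneg _)]
  have habsm : ∀ j, |D.lamσε j ^ 2| = D.lamσε j ^ 2 := fun j => abs_of_nonneg (sq_nonneg _)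
  have hr1 := radius_le_left x
  have hr2 := radius_le_right x
  refine ⟨hρ0, by linarith, by linarith, by linarith, by linarith, ?_, ?_, ?_, ?_, ?_, ?_, ?_⟩
  · exact hasSummableGerms_gp hD hx0 hx1 hρ0 hρ _ _ _ (hA₁.1.congr fun i => by rw [habs2])
      (hA₂.1.congr fun i => by rw [habs2])
  · exact hasSummableGerms_gp hD hx0 hx1 hρ0 hρ _ _ _ (hA₁.2.1.congr fun i => by rw [habs2])
      (hA₂.2.1.congr fun i => by rw [habs2])
  · exact hasSummableGerms_gmm hD hx0 hx1 hρ0 hρ hne hs4 hσ1 _ _ _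
      (hA₁.2.2.congr fun j => by rw [habs3]) (hA₂.2.2.congr fun j => by rw [habs3])
  · exact hasSummableGerms_gp hD hx0 hx1 hρ0 hρ _ _ _ (summable_lam_mul_gp hD hX₁.1 hX₁.2)
      (summable_lam_mul_gp hD hX₂.1 hX₂.2)
  · exact hasSummableGerms_gpm hD hx0 hx1 hρ0 hρ hne hs4 _ _ _
      (hA₁.2.2.congr fun j => by rw [habsm]) (hA₂.2.2.congr fun j => by rw [habsm])
  · exact hasSummableGerms_gp hD hx0 hx1 hρ0 hρ _ _ _ (summable_lam_mul_gp hD hX₁.1 hX₁.2)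
      (summable_lam_mul_gp hD hX₂.1 hX₂.2)
  · exact hasSummableGerms_gpm hD hx0 hx1 hρ0 hρ hne hs4 _ _ _
      (hA₁.2.2.congr fun j => by rw [habsm]) (hA₂.2.2.congr fun j => by rw [habsm])

/-- **T4-A (termwise action of derivative functionals), proved.** [folklore] -/
theorem appliesTermwise_of_isTaylorAt_of_axioms (hD : D.SatisfiesBootstrapAxioms) (hne : D.Δσ ≠ D.Δε)
    (hs4 : 4 * D.Δσε ^ 2 ≠ 1) (hσ1 : D.Δσ ≠ 1) (hx0 : 0 < x) (hx1 : x < 1) (hρ0 : 0 < ρ)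
    (hρ : ρ < x * (1 - x)) (α : CrossingFunctional) (hα : IsTaylorAt α x x) :
    α.AppliesTermwise D :=
  appliesTermwise_of_isTaylorAt α hα D hD.2.2.2.1
    (hasCrossFGerms_of_axioms hD hne hs4 hσ1 hx0 hx1 hρ0 hρ)

end Axioms

/-- **Box exclusion by a derivative functional.** A crossing functional whose components are finite
combinations of Taylor coefficients at a diagonal point `(x,x)`, `0 < x < 1`, and which is positive
(`IsPositiveAt`) at every point of a set `Q` of external dimensions with `Δ_σ ≠ Δ_ε`,
`4(Δ_σ-Δ_ε)² ≠ 1`, `Δ_σ ≠ 1` on `Q`, excludes `Q`: `BoxExcluded Q`. [folklore] -/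
theorem boxExcluded_of_taylorCrossing (Q : Set (ℝ × ℝ)) {x : ℝ} (hx0 : 0 < x) (hx1 : x < 1)
    (α : CrossingFunctional) (hα : IsTaylorAt α x x)
    (hQ : ∀ p ∈ Q, p.1 ≠ p.2 ∧ 4 * (p.1 - p.2) ^ 2 ≠ 1 ∧ p.1 ≠ 1)
    (hpos : ∀ p ∈ Q, α.IsPositiveAt p.1 p.2) : BoxExcluded Q := by
  refine boxExcluded_of_isTaylorAt Q α hα (fun D hD hmem => ?_) hpos
  obtain ⟨h1, h2, h3⟩ := hQ _ hmem
  have hρ : x * (1 - x) / 2 < x * (1 - x) := by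
    have : 0 < x * (1 - x) := mul_pos hx0 (by linarith)
    linarith
  exact ⟨x * (1 - x) / 2, hasCrossFGerms_of_axioms hD h1 (by unfold SigmaEpsilonData.Δσε; exact h2)
    h3 hx0 hx1 (by have : 0 < x * (1 - x) := mul_pos hx0 (by linarith); linarith) hρ⟩

/-- **The form used on the Ising window**: if `Δ_σ < 1` and `Δ_ε > Δ_σ + 1/2` on `Q` (true on
`W = [0.505, 0.535] × [1.2, 1.6]`), a derivative crossing functional at `(x,x)` positive on `Q`
excludes `Q`. [folklore] -/
theorem boxExcluded_of_taylorCrossing_of_gap (Q : Set (ℝ × ℝ)) {x : ℝ} (hx0 : 0 < x)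
    (hx1 : x < 1) (α : CrossingFunctional) (hα : IsTaylorAt α x x)
    (hQ : ∀ p ∈ Q, p.1 < 1 ∧ p.1 + 1 / 2 < p.2) (hpos : ∀ p ∈ Q, α.IsPositiveAt p.1 p.2) :
    BoxExcluded Q := by
  refine boxExcluded_of_taylorCrossing Q hx0 hx1 α hα (fun p hp => ?_) hpos
  obtain ⟨h1, h2⟩ := hQ p hp
  refine ⟨by linarith, ?_, h1.ne⟩
  have h3 : 1 < 4 * (p.1 - p.2) ^ 2 := by nlinarith
  exact ne_of_gt h3

end Summit.CriticalPhenomena.Ising3D
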